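/-
Copyright (c) 2026. All rights reserved.
Released under Apache 2.0 license as described in the file LICENSE.
Authors: abc-iut cell — seat abc-iut-L6-t15 (gen 3): proof-only companion to `HolomorphicCores`
([AbsTopIII] Prop 2.5), no new definitions.
-/
import Literature.AnabelianGeometry.AbsoluteAnabelian.ParallelogramsPlanarFrames

/-!
# Planar geometry behind [AbsTopIII] Prop 2.5, X: producing strictly co-oriented frames

Proof-only companion (no definitions) to `HolomorphicCores.lean`, continuing `ParallelogramsPlanarFrames`.
Algebraic criteria for the STRICT CO-ORIENTATION of two corner frames `(e₁, e₂)`, `(f₁, f₂)` at `p`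
(Prop 2.5 (d)): it holds as soon as `f₁ = α e₁ + β e₂` and `e₂ = γ f₁ + δ f₂` with positive
coefficients.  Instances used to connect frames of the same orientation sign: the "square step" from an
arbitrary frame to a square frame `(g, σ i g)`, the "rotation step" between square frames whose ratio lies
in the open quadrant `{a + σ b i : a, b > 0}`, and the "bisector" splitting a ratio in the open half-plane
into two such quadrant steps.

Refereed classical mathematics (S. Mochizuki, *Topics in absolute anabelian geometry III*, §2; kurims
pages); nothing here bears on the disputed parts of IUT.
-/

namespace Literature.AnabelianGeometry.AbsoluteAnabelian

open _root_.Complex _root_.Set _root_.Topology _root_.Filter _root_.Metric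

noncomputable section

/-! ### The one-step criterion -/

/-- If `f = α e₁ + β e₂` with `α, β > 0` (`e₁, e₂` independent), the segment `[p, p + f]` meets the open
parallelogram with corner `p` and edges `e₁, e₂` in infinitely many points.
(Auxiliary.) [cite: MochizukiAbsTopIII2015, Proposition 2.5 (d) p.56] -/
theorem segment_inter_openParallelogram_infinite {p f e₁ e₂ : ℂ} {α β : ℝ}
    (he : LinearIndependent ℝ ![e₁, e₂]) (hα : 0 < α) (hβ : 0 < β)
    (hf : f = (α : ℂ) * e₁ + (β : ℂ) * e₂) :
    (segment ℝ p (p + f) ∩ openParallelogram p e₁ e₂).Infinite := by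
  have hf0 : f ≠ 0 := by
    intro h0
    have := (LinearIndependent.pair_iff.1 he) α β (by
      rw [Complex.real_smul, Complex.real_smul, ← hf, h0])
    linarith [this.1]
  set r₀ : ℝ := (1 + α + β)⁻¹ with hr₀
  have hr₀pos : 0 < r₀ := by positivity
  have hr₀α : r₀ * α < 1 := by
    rw [hr₀, inv_mul_lt_iff₀ (by positivity)]; linarith
  have hr₀β : r₀ * β < 1 := by
    rw [hr₀, inv_mul_lt_iff₀ (by positivity)]; linarith
  have hr₀1 : r₀ ≤ 1 := by
    rw [hr₀]; exact inv_le_one_of_one_le₀ (by linarith)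
  have hsub : (fun r : ℝ => p + (r : ℂ) * f) '' Ioo 0 r₀ ⊆ segment ℝ p (p + f) ∩ openParallelogram p e₁ e₂ := by
    rintro _ ⟨r, ⟨hr0, hr1⟩, rfl⟩
    refine ⟨mem_segment_of_eq_add_mul (μ := r) hr0.le (by linarith) (by ring), ?_⟩
    refine ⟨r * α, r * β, by positivity, by nlinarith, by positivity, by nlinarith, ?_⟩
    rw [hf]; push_cast; ring
  refine Set.Infinite.mono hsub ((Ioo_infinite hr₀pos).image ?_)
  intro r₁ _ r₂ _ h
  have h' : ((r₁ : ℂ) - r₂) * f = 0 := by linear_combination h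
  have := (mul_eq_zero.1 h').resolve_right hf0
  exact_mod_cast sub_eq_zero.1 this

/-- The closed parallelogram with corner `p` and edge vectors `e₁, e₂` lies in the closed ball of radius
`‖e₁‖ + ‖e₂‖` around `p`. (Auxiliary.) [cite: MochizukiAbsTopIII2015, Proposition 2.5 (proof) pp.55–57] -/
theorem closure_openParallelogram_subset_closedBall (p e₁ e₂ : ℂ) :
    closure (openParallelogram p e₁ e₂) ⊆ closedBall p (‖e₁‖ + ‖e₂‖) := by
  refine closure_minimal ?_ isClosed_closedBall
  rintro _ ⟨s, t, hs, hs1, ht, ht1, rfl⟩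
  rw [mem_closedBall, dist_eq_norm, show p + (s : ℂ) * e₁ + (t : ℂ) * e₂ - p = (s : ℂ) * e₁ + (t : ℂ) * e₂ by ring]
  refine (norm_add_le _ _).trans (add_le_add ?_ ?_)
  · rw [norm_mul, Complex.norm_real, Real.norm_of_nonneg hs.le]
    exact mul_le_of_le_one_left (norm_nonneg _) hs1.le
  · rw [norm_mul, Complex.norm_real, Real.norm_of_nonneg ht.le]
    exact mul_le_of_le_one_left (norm_nonneg _) ht1.le

/-- **Prop 2.5 (d)**, the one-step criterion: two corner frames `(e₁, e₂)`, `(f₁, f₂)` at `p` (closures in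
`U`) with `f₁ = α e₁ + β e₂`, `e₂ = γ f₁ + δ f₂`, all coefficients positive, are STRICTLY CO-ORIENTED.
[cite: MochizukiAbsTopIII2015, Proposition 2.5 (d) p.56] -/
theorem Parallelograms.strictlyCoOriented_of_pos_coeffs {U : Set ℂ} (hU : IsOpen U) {𝒬 : Set (Set U)}
    (h𝒬 : ∀ Q ∈ 𝒬, Subtype.val '' Q ∈ parallelogramsIn U)
    (h𝒮 : ∀ Q : Set U, Subtype.val '' Q ∈ squaresIn U → Q ∈ 𝒬) {p : U} {e₁ e₂ f₁ f₂ : ℂ}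
    (he : LinearIndependent ℝ ![e₁, e₂]) (hf : LinearIndependent ℝ ![f₁, f₂])
    (hce : closure (openParallelogram (p : ℂ) e₁ e₂) ⊆ U)
    (hcf : closure (openParallelogram (p : ℂ) f₁ f₂) ⊆ U) {α β γ δ : ℝ} (hα : 0 < α) (hβ : 0 < β)
    (hγ : 0 < γ) (hδ : 0 < δ) (h1 : f₁ = (α : ℂ) * e₁ + (β : ℂ) * e₂)
    (h2 : e₂ = (γ : ℂ) * f₁ + (δ : ℂ) * f₂) :
    Parallelograms.StrictlyCoOriented 𝒬 (Subtype.val ⁻¹' openParallelogram (p : ℂ) e₁ e₂)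
      (Subtype.val ⁻¹' segment ℝ (p : ℂ) (p + e₁), Subtype.val ⁻¹' segment ℝ (p : ℂ) (p + e₂))
      (Subtype.val ⁻¹' openParallelogram (p : ℂ) f₁ f₂)
      (Subtype.val ⁻¹' segment ℝ (p : ℂ) (p + f₁), Subtype.val ⁻¹' segment ℝ (p : ℂ) (p + f₂)) := by
  have hPU : openParallelogram (p : ℂ) e₁ e₂ ⊆ U := subset_closure.trans hce
  have hPU' : openParallelogram (p : ℂ) f₁ f₂ ⊆ U := subset_closure.trans hcf
  have hf₁ : f₁ ≠ 0 := by simpa using hf.ne_zero 0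
  have he₂ : e₂ ≠ 0 := by simpa using he.ne_zero 1
  have hmem : ∀ {a b : ℂ} (hab : LinearIndependent ℝ ![a, b]) (s t : ℝ), 0 ≤ s → s ≤ 1 → 0 ≤ t → t ≤ 1 →
      (p : ℂ) + (s : ℂ) * a + (t : ℂ) * b ∈ closure (openParallelogram (p : ℂ) a b) :=
    fun hab s t hs hs1 ht ht1 => (mem_closure_openParallelogram_iff hab).2 ⟨s, t, hs, hs1, ht, ht1, rfl⟩
  have hls₁ : Parallelograms.IsLineSegment 𝒬 (Subtype.val ⁻¹' segment ℝ (p : ℂ) (p + f₁)) :=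
    Parallelograms.isLineSegment_of_segment_subset hU h𝒬 h𝒮 (by simpa using hf₁)
      (((convex_closure_openParallelogram _ _ _).segment_subset
        (by simpa using hmem hf 0 0 le_rfl zero_le_one le_rfl zero_le_one)
        (by simpa using hmem hf 1 0 zero_le_one le_rfl le_rfl zero_le_one)).trans hcf)
  have hls₂ : Parallelograms.IsLineSegment 𝒬 (Subtype.val ⁻¹' segment ℝ (p : ℂ) (p + e₂)) :=
    Parallelograms.isLineSegment_of_segment_subset hU h𝒬 h𝒮 (by simpa using he₂)
      (((convex_closure_openParallelogram _ _ _).segment_subset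
        (by simpa using hmem he 0 0 le_rfl zero_le_one le_rfl zero_le_one)
        (by simpa using hmem he 0 1 le_rfl zero_le_one zero_le_one le_rfl)).trans hce)
  refine ⟨⟨hls₁, ?_⟩, ⟨hls₂, ?_⟩⟩
  · rw [← preimage_inter]
    exact preimage_val_infinite (inter_subset_right.trans hPU)
      (segment_inter_openParallelogram_infinite he hα hβ h1)
  · rw [← preimage_inter]
    exact preimage_val_infinite (inter_subset_right.trans hPU')
      (segment_inter_openParallelogram_infinite hf hγ hδ h2)

/-! ### The determinant and square frames -/

/-- `det(e₁, ζ e₁) = ‖e₁‖² · Im ζ` in coordinates. (Auxiliary.) [cite: MochizukiAbsTopIII2015, Proposition 2.5 (proof) pp.55–57] -/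
theorem det_mul_self (e ζ : ℂ) :
    e.re * (ζ * e).im - e.im * (ζ * e).re = ζ.im * (e.re * e.re + e.im * e.im) := by
  simp only [Complex.mul_re, Complex.mul_im]; ring

/-- The pair `(g, σ i g)` (`σ = ±1`, `g ≠ 0`) is independent. (Auxiliary.) [cite: MochizukiAbsTopIII2015, Proposition 2.5 (proof) pp.55–57] -/
theorem linearIndependent_pair_sigma_I {g : ℂ} (hg : g ≠ 0) {σ : ℝ} (hσ : σ = 1 ∨ σ = -1) :
    LinearIndependent ℝ ![g, (σ : ℂ) * I * g] := by
  have h := linearIndependent_pair_smul (linearIndependent_pair_mul_I hg) (a := 1) (b := σ) one_ne_zero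
    (by rcases hσ with rfl | rfl <;> norm_num)
  simpa [mul_assoc] using h

/-- The determinant of the square frame `(g, σ i g)` is `σ ‖g‖²`. (Auxiliary.) [cite: MochizukiAbsTopIII2015, Proposition 2.5 (proof) pp.55–57] -/
theorem det_square_frame (g : ℂ) (σ : ℝ) :
    g.re * ((σ : ℂ) * I * g).im - g.im * ((σ : ℂ) * I * g).re = σ * (g.re * g.re + g.im * g.im) := by
  simp only [Complex.mul_re, Complex.mul_im, Complex.ofReal_re, Complex.ofReal_im, Complex.I_re,
    Complex.I_im]
  ring

/-- **Square step** (Prop 2.5 (d)): from any corner frame `(e₁, e₂)` with orientation sign `σ` one reaches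
a square frame `(g, σ i g)` in one step: `g = a e₁ + b e₂`, `e₂ = γ g + δ (σ i g)` with positive
coefficients. [cite: MochizukiAbsTopIII2015, Proposition 2.5 (d) p.56] -/
theorem exists_square_step {e₁ e₂ : ℂ} (he : LinearIndependent ℝ ![e₁, e₂]) {σ : ℝ} (hσ : σ = 1 ∨ σ = -1)
    (hsgn : 0 < σ * (e₁.re * e₂.im - e₁.im * e₂.re)) :
    ∃ g : ℂ, g ≠ 0 ∧ ∃ a b γ δ : ℝ, 0 < a ∧ 0 < b ∧ 0 < γ ∧ 0 < δ ∧
      g = (a : ℂ) * e₁ + (b : ℂ) * e₂ ∧ e₂ = (γ : ℂ) * g + (δ : ℂ) * ((σ : ℂ) * I * g) := by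
  have he₁ : e₁ ≠ 0 := by simpa using he.ne_zero 0
  set ζ : ℂ := e₂ / e₁ with hζ
  have he₂ : e₂ = ζ * e₁ := by rw [hζ]; field_simp
  set x : ℝ := ζ.re with hx
  set y : ℝ := ζ.im with hy
  have hζxy : ζ = (x : ℂ) + (y : ℂ) * I := by rw [hx, hy, Complex.re_add_im]
  have hn : 0 < e₁.re * e₁.re + e₁.im * e₁.im := by
    have : e₁.re ≠ 0 ∨ e₁.im ≠ 0 := by
      by_contra h; push Not at h; exact he₁ (Complex.ext h.1 h.2)
    rcases this with h | h
    · nlinarith [mul_self_pos.2 h, mul_self_nonneg e₁.im]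
    · nlinarith [mul_self_pos.2 h, mul_self_nonneg e₁.re]
  have hσy : 0 < σ * y := by
    rw [he₂, det_mul_self, ← hy, show σ * (y * (e₁.re * e₁.re + e₁.im * e₁.im)) =
      (σ * y) * (e₁.re * e₁.re + e₁.im * e₁.im) by ring] at hsgn
    exact (pos_iff_pos_of_mul_pos hsgn).2 hn
  -- the coefficients
  obtain ⟨γ₀, hγ₀⟩ : ∃ γ₀ : ℝ, γ₀ = |x| / (σ * y) + 1 := ⟨_, rfl⟩
  have hγ₀pos : 0 < γ₀ := by rw [hγ₀]; positivity
  obtain ⟨a, ha⟩ : ∃ a : ℝ, a = (x ^ 2 + y ^ 2) / ((σ * y) * (γ₀ ^ 2 + 1)) := ⟨_, rfl⟩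
  obtain ⟨b, hb⟩ : ∃ b : ℝ, b = (γ₀ * (σ * y) - x) / ((σ * y) * (γ₀ ^ 2 + 1)) := ⟨_, rfl⟩
  have hy0 : y ≠ 0 := by intro h; rw [h, mul_zero] at hσy; exact lt_irrefl _ hσy
  have hapos : 0 < a := by
    rw [ha]; apply div_pos _ (by positivity); nlinarith [mul_self_pos.2 hy0]
  have hbpos : 0 < b := by
    rw [hb]; apply div_pos _ (by positivity)
    have : x ≤ |x| := le_abs_self x
    have h2 : γ₀ * (σ * y) = |x| + σ * y := by
      rw [hγ₀, add_mul, div_mul_cancel₀ _ hσy.ne', one_mul]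
    linarith
  refine ⟨(a : ℂ) * e₁ + (b : ℂ) * e₂, ?_, a, b, γ₀, 1, hapos, hbpos, hγ₀pos, one_pos, rfl, ?_⟩
  · intro h0
    have := (LinearIndependent.pair_iff.1 he) a b (by rw [Complex.real_smul, Complex.real_smul, h0])
    linarith [this.1]
  · -- the identity `e₂ = γ₀ g + σ i g`, i.e. `ζ = (γ₀ + σ i) (a + b ζ)`
    rw [he₂, hζxy]
    have hsN : (σ * y) * (γ₀ ^ 2 + 1) ≠ 0 := by positivity
    have key1 : γ₀ * (a + b * x) - σ * (b * y) = x := by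
      rw [ha, hb]; field_simp
      rcases hσ with rfl | rfl <;> ring
    have key2 : σ * (a + b * x) + γ₀ * (b * y) = y := by
      rw [ha, hb]; field_simp
      rcases hσ with rfl | rfl <;> ring
    apply Complex.ext
    · simp only [Complex.add_re, Complex.mul_re, Complex.ofReal_re, Complex.ofReal_im, Complex.I_re,
        Complex.I_im, Complex.add_im, Complex.mul_im]
      linear_combination (-e₁.re) * key1 + e₁.im * key2
    · simp only [Complex.add_re, Complex.mul_re, Complex.ofReal_re, Complex.ofReal_im, Complex.I_re,
        Complex.I_im, Complex.add_im, Complex.mul_im]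
      linear_combination (-e₁.im) * key1 + (-e₁.re) * key2

/-- **Rotation step** (Prop 2.5 (d)): if `g = a f + b (σ i f)` with `a, b > 0`, then also
`σ i f = γ g + δ (σ i g)` with `γ, δ > 0` — so the square frames `(f, σ i f)` and `(g, σ i g)` satisfy the
one-step criterion. [cite: MochizukiAbsTopIII2015, Proposition 2.5 (d) p.56] -/
theorem rotation_step {f g : ℂ} {σ a b : ℝ} (hσ : σ = 1 ∨ σ = -1) (ha : 0 < a) (hb : 0 < b)
    (hg : g = (a : ℂ) * f + (b : ℂ) * ((σ : ℂ) * I * f)) :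
    ∃ γ δ : ℝ, 0 < γ ∧ 0 < δ ∧ (σ : ℂ) * I * f = (γ : ℂ) * g + (δ : ℂ) * ((σ : ℂ) * I * g) := by
  have hN : 0 < a ^ 2 + b ^ 2 := by positivity
  refine ⟨b / (a ^ 2 + b ^ 2), a / (a ^ 2 + b ^ 2), by positivity, by positivity, ?_⟩
  have key : ((b / (a ^ 2 + b ^ 2) : ℝ) : ℂ) * ((a : ℂ) + (b : ℂ) * ((σ : ℂ) * I)) +
      ((a / (a ^ 2 + b ^ 2) : ℝ) : ℂ) * ((σ : ℂ) * I * ((a : ℂ) + (b : ℂ) * ((σ : ℂ) * I))) = (σ : ℂ) * I := by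
    have hN' : ((a ^ 2 + b ^ 2 : ℝ) : ℂ) ≠ 0 := by exact_mod_cast hN.ne'
    apply Complex.ext <;>
      simp only [Complex.add_re, Complex.mul_re, Complex.ofReal_re, Complex.ofReal_im, Complex.I_re,
        Complex.I_im, Complex.add_im, Complex.mul_im] <;>
      rcases hσ with rfl | rfl <;> field_simp <;> ring
  rw [hg]
  linear_combination (-f) * key

/-- **Bisector** (Prop 2.5 (d)): if `g = u f + v (σ i f)` with `v > 0` (the ratio `g/f` lies in the open
half-plane on the `σ` side), there is an intermediate `h = s f + t (σ i f)`, `s, t > 0`, with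
`g = a' h + b' (σ i h)`, `a', b' > 0`: two rotation steps lead from `(f, σ i f)` to `(g, σ i g)`.
[cite: MochizukiAbsTopIII2015, Proposition 2.5 (d) p.56] -/
theorem bisector_step {f g : ℂ} {σ u v : ℝ} (hσ : σ = 1 ∨ σ = -1) (hv : 0 < v)
    (hg : g = (u : ℂ) * f + (v : ℂ) * ((σ : ℂ) * I * f)) :
    ∃ (s t : ℝ) (h : ℂ), 0 < s ∧ 0 < t ∧ h = (s : ℂ) * f + (t : ℂ) * ((σ : ℂ) * I * f) ∧
      ∃ a' b' : ℝ, 0 < a' ∧ 0 < b' ∧ g = (a' : ℂ) * h + (b' : ℂ) * ((σ : ℂ) * I * h) := by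
  -- choose `(s, t)` with `u s + v t > 0`, `v s - u t > 0`
  obtain ⟨s, t, hs, ht, h1, h2⟩ : ∃ s t : ℝ, 0 < s ∧ 0 < t ∧ 0 < u * s + v * t ∧ 0 < v * s - u * t := by
    rcases le_or_gt 0 u with hu | hu
    · exact ⟨u + v, v, by positivity, hv, by nlinarith, by nlinarith⟩
    · exact ⟨v, v - u, hv, by linarith, by nlinarith, by nlinarith⟩
  have hM : 0 < s ^ 2 + t ^ 2 := by positivity
  refine ⟨s, t, _, hs, ht, rfl, (u * s + v * t) / (s ^ 2 + t ^ 2), (v * s - u * t) / (s ^ 2 + t ^ 2),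
    by positivity, by positivity, ?_⟩
  have key : (((u * s + v * t) / (s ^ 2 + t ^ 2) : ℝ) : ℂ) * ((s : ℂ) + (t : ℂ) * ((σ : ℂ) * I)) +
      (((v * s - u * t) / (s ^ 2 + t ^ 2) : ℝ) : ℂ) * ((σ : ℂ) * I * ((s : ℂ) + (t : ℂ) * ((σ : ℂ) * I))) =
      (u : ℂ) + (v : ℂ) * ((σ : ℂ) * I) := by
    have hM' : ((s ^ 2 + t ^ 2 : ℝ) : ℂ) ≠ 0 := by exact_mod_cast hM.ne'
    apply Complex.ext <;>
      simp only [Complex.add_re, Complex.mul_re, Complex.ofReal_re, Complex.ofReal_im, Complex.I_re,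
        Complex.I_im, Complex.add_im, Complex.mul_im] <;>
      rcases hσ with rfl | rfl <;> field_simp <;> ring
  rw [hg]
  linear_combination (-f) * key

end

end Literature.AnabelianGeometry.AbsoluteAnabelian
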